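import Literature.AnabelianGeometry.SemiGraphs.OrbitGraph
import HarnessLib

/-!
# Finiteness of the underlying semi-graph of a finite covering of a finite `𝒢` ([SemiAnbd] §3 pp. 37, 41)

Mochizuki, *Semi-graphs of anabelioids*, Publ. RIMS **42** (2006), §3: p. 37 (the underlying semi-graph
`𝔾_S` of a covering, `OrbitGraph.lean`) and the proof of Thm. 3.7 (iii), p. 41: "Since the semi-graphs
`𝔾_j` are all finite, we thus conclude that we may choose a compatible system of such subjoints"
[cite: MochizukiSemiAnbd2006, Thm 3.7(iii) p.41] — the finiteness of the levels `𝔾_j`, which holds when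
(and, for genuine levels, only when) the underlying semi-graph `𝔾` of `𝒢` is finite (cell ruling φ2: the
Thm. 3.7 (iii) ladder is cut to finite `𝔾`; interface fields `FiniteLevelData.finiteVertex` /
`finiteBranch` of `TemperedLevelData.lean`).

Proof-only file: a finite object `S` of `B^cov(𝒢)` over a `𝒢` with finitely many vertices (resp. edges)
has finitely many vertex-orbits (resp. edge-orbits, branches) in its underlying semi-graph
(`CovObj.finite_oVertex`, `CovObj.finite_oEdge`, `CovObj.finite_orbitGraph_branch`,
`CovObj.orbitGraph_isFinite`); and a semi-graph with finitely many edges has finitely many branches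
(`SemiGraph.finite_branch`). Seat abc-iut-L3-t6. Nothing here bears on [IUTchIII] Cor. 3.12.
-/

namespace Literature.AnabelianGeometry.SemiGraphs

universe u

namespace SemiGraph

/-- A semi-graph with finitely many edges has finitely many branches (each edge has exactly two).
[cite: MochizukiSemiAnbd2006, §1 p.11] -/
theorem finite_branch (G : SemiGraph.{u}) [Finite G.Edge] : Finite G.Branch := by
  have hfin : ∀ e : G.Edge, Finite {b : G.Branch // G.edgeOf b = e} := by
    intro e
    obtain ⟨b₁, b₂, -, h₁, h₂, hall⟩ := G.two_branches e
    refine Finite.of_surjective (fun i : Bool => if i then (⟨b₁, h₁⟩ : {b // G.edgeOf b = e})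
      else ⟨b₂, h₂⟩) ?_
    rintro ⟨b, hb⟩
    rcases hall b hb with rfl | rfl
    · exact ⟨true, rfl⟩
    · exact ⟨false, rfl⟩
  exact Finite.of_injective
    (fun b : G.Branch => (⟨G.edgeOf b, b, rfl⟩ : Σ e : G.Edge, {b : G.Branch // G.edgeOf b = e}))
    fun b₁ b₂ h => congrArg (fun p : Σ e : G.Edge, {b : G.Branch // G.edgeOf b = e} => p.2.1) h

/-- A finite semi-graph has finitely many branches. [cite: MochizukiSemiAnbd2006, §1 p.11] -/
theorem IsFinite.finite_branch {G : SemiGraph.{u}} (h : G.IsFinite) : Finite G.Branch :=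
  haveI := h.finite_edge
  G.finite_branch

end SemiGraph

namespace ProfiniteSemiGraph

variable {𝒢 : ProfiniteSemiGraph.{u}} (S : CovObj 𝒢)

/-- A finite covering of a `𝒢` with finitely many vertices has finitely many vertex-orbits.
[cite: MochizukiSemiAnbd2006, Thm 3.7(iii) p.41] -/
theorem CovObj.finite_oVertex [Finite 𝒢.graph.Vertex] (hS : S.IsFinite) : Finite S.OVertex := by
  haveI : ∀ v, Finite (S.SV v).obj.V := hS.finite_V
  exact Finite.of_surjective _ (Quot.mk_surjective (r := S.VRel))

/-- A finite covering of a `𝒢` with finitely many edges has finitely many edge-orbits.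
[cite: MochizukiSemiAnbd2006, Thm 3.7(iii) p.41] -/
theorem CovObj.finite_oEdge [Finite 𝒢.graph.Edge] (hS : S.IsFinite) : Finite S.OEdge := by
  haveI : ∀ e, Finite (S.SE e).obj.V := hS.finite_E
  exact Finite.of_surjective _ (Quot.mk_surjective (r := S.ERel))

/-- A finite covering of a `𝒢` with finitely many edges has an underlying semi-graph with finitely many
branches. [cite: MochizukiSemiAnbd2006, Thm 3.7(iii) p.41] -/
theorem CovObj.finite_orbitGraph_branch [Finite 𝒢.graph.Edge] (hS : S.IsFinite) :
    Finite S.orbitGraph.Branch := by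
  haveI := 𝒢.graph.finite_branch
  haveI := S.finite_oEdge hS
  exact Subtype.finite

/-- **The underlying semi-graph `𝔾_S` of a finite covering `S` of a `𝒢` with finite underlying semi-graph
is finite** (the finiteness of the levels `𝔾_j` used on p. 41). [cite: MochizukiSemiAnbd2006, Thm 3.7(iii) p.41] -/
theorem CovObj.orbitGraph_isFinite (h𝒢 : 𝒢.graph.IsFinite) (hS : S.IsFinite) : S.orbitGraph.IsFinite :=
  haveI := h𝒢.finite_vertex
  haveI := h𝒢.finite_edge
  ⟨S.finite_oVertex hS, S.finite_oEdge hS⟩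

end ProfiniteSemiGraph

end Literature.AnabelianGeometry.SemiGraphs
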